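import Mathlib.Tactic.Linarith
import Mathlib.Tactic.NormNum
import Mathlib.Tactic.Ring
import HarnessLib

/-!
# The (0,1) cell of the ι-window, XXXIII (companion D): the product ground `B₁ × B₂`, XX — THE CORNER IV, ADDENDUM 2: the Hartshorne–Serre
# model of branch (I) of (Q-RES) (report [XXXIII] `H2-ZERO-ONE-33.md` §14): arithmetic shadows

Family `hodge`, b2b cell `hweil` (helper of item stmt-HodgeConjecture-2524). Report
`run/shared/lean/b2b/hodge-weil/b2b-hweil-pv1-g45/H2-ZERO-ONE-33.md` ([XXXIII]) §14 (ADDENDUM 2). Context: branch (I), `n₃ = n′ = 10` (RB-22 type 1,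
shape (R-PIN₃)): the partner is a Hartshorne–Serre extension `0 → 𝓐 → 𝓠 → 𝓘_W ⊗ 𝓑 → 0` with `𝓐 = 𝒪(2Θ₀)^5P_β ⊠ λ₃`, `𝓑 = P_β ⊠ λ₄` (`deg λ₃ = d₃ ∈ [10,14]`,
`λ₃λ₄ = K₂²`), `W` an ι-invariant l.c.i. curve with `W·f′ = 70`, `W·θ₁ = 44 + 20d₃`, `ω_W ≅ 𝒪_H(−10θ₁ + (6 − 2d₃)f′)|_W`, `W ∩ S` finite; PROPOSITION HS-I:
such `W` gives a locally free `𝓠` with the type-1 numerics (the problem is unobstructed), ι-traceless iff an invariant generating class exists; MODEL `W₀`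
(`d₃ = 10`): `2·(2·17 + 1) = 70` from 17 ι-pairs of double vertical fibres plus one ι-fixed one (conormal degree `2d₃ − 4 = 16`), `4·(2·30 + 1) = 244` from
30 ι-pairs of doubled theta-translates plus one ι-fixed one (conormal degree `22`), `χ(𝒪_{W₀}) = 35·14 + 61·20 = 1710 = 10 + 170·10`; PARITY: all-double
configurations in free ι-orbits alone are impossible (`4 ∤ 70`, `8 ∤ 244`). The theorems below are that integer bookkeeping; none claims geometry.
HONEST FRAMING: census work inside the ladder's H2 test ((0,1) cell) on the SPECIAL fourfold `X₀`; nothing here is a rung; no case of the Hodge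
conjecture is proved; no statement of [Markman 2025] / [Perry 2026] / [EdGFS 2025] is used.
-/

-- mandated namespace `Summit.HodgeConjecture.HodgeConjecture.…` (Problem = Summit) trips `linter.dupNamespace`; the lakefile disables it
-- tree-wide (weak option), restated here so stand-alone elaboration is warning-free too.
set_option linter.dupNamespace false

namespace Summit.HodgeConjecture.HodgeConjecture.WeilTypeLadder

section ProductGroundTwentyAddTwo

/-- **[XXXIII] 14.1 (the Chern classes of the Hartshorne–Serre partner come out right).** With `c₁(𝓐) = 10θ₁ + d₃f′`, `c₁(𝓑) = (4 − d₃)f′`,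
`[W] = 70ϖ′ + (22 + 10d₃)f′θ₁` (`W·f′ = 70`, `W·θ₁ = 44 + 20d₃`): `c₂(𝓠) = c₁(𝓐)c₁(𝓑) + [W]` has `f′θ₁`-coefficient `10(4 − d₃) + (22 + 10d₃) = 62 = μ′` and
`ϖ′`-coefficient `70 = m′`, for every `d₃`; and `n′ = 10 + 0`, `d′ = d₃ + (4 − d₃) = 4`. [`ring`] -/
theorem pg20c_chern_check :
    ∀ d₃ : ℤ, 10 * (4 - d₃) + (22 + 10 * d₃) = 62 ∧ 2 * (22 + 10 * d₃) = 44 + 20 * d₃ ∧ d₃ + (4 - d₃) = 4 ∧ (10:ℤ) + 0 = 10 := by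
  intro d₃
  refine ⟨by ring, by ring, by ring, by norm_num⟩

/-- **[XXXIII] 14.2 (the conormal degrees of the ribbons, and the vanishings used).** Vertical ribbon on `{x} × C₂`: `L = λ₃²K₂⁻²`, `deg L = 2d₃ − 4 ≥ 16 >
2 = 2g − 2` for `d₃ ≥ 10` (so `H¹(L) = 0`, `L` base-point free, `Pic W = Pic Γ`), `κ = 2d₃ − 6`, `χ`-contribution `κ = 2·κ/2` for a double structure:
`2(1 − 2) + (2d₃ − 4) = 2d₃ − 6`. Horizontal ribbon on a theta-translate `D × {c}` (`g(D) = 2`, `D·Θ = 2`): `L = ω_D ⊗ 𝒪(10Θ₀)|_D`, `deg L = 2 + 20 = 22 > 2`,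
`κ = 10·2 = 20`, `χ`-contribution `2(1 − 2) + 22 = 20`. The unobstructedness degrees: on `C₂` the class `λ₃λ₄⁻¹` has degree `2d₃ − 4 > 2` (`H¹ = 0`).
[`omega`] -/
theorem pg20c_ribbon_degrees :
    (∀ d₃ : ℤ, 10 ≤ d₃ → 16 ≤ 2 * d₃ - 4 ∧ 2 < 2 * d₃ - 4 ∧ 2 * (1 - 2) + (2 * d₃ - 4) = 2 * d₃ - 6) ∧
    ((2:ℤ) + 20 = 22 ∧ (2:ℤ) < 22 ∧ 2 * ((1:ℤ) - 2) + 22 = 20 ∧ (10:ℤ) * 2 = 20) := by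
  refine ⟨fun d₃ h => ⟨by omega, by omega, by omega⟩, by norm_num⟩

/-- **[XXXIII] 14.3 (MODEL `W₀`, `d₃ = 10`: the counts).** 17 ι-pairs + 1 ι-fixed double vertical fibre: `W·f′ = 2·(2·17 + 1) = 70`; 30 ι-pairs + 1 ι-fixed
doubled theta-translate: `W·θ₁ = 4·(2·30 + 1) = 244 = 44 + 20·10`; `χ(𝒪_{W₀}) = 35·14 + 61·20 = 1710 = 10 + 170·10`; `W₀ ∩ S` has length `61·4 = 244 = |P′|`.
[`norm_num`] -/
theorem pg20c_model_counts :
    (2:ℤ) * (2 * 17 + 1) = 70 ∧ (4:ℤ) * (2 * 30 + 1) = 244 ∧ (44:ℤ) + 20 * 10 = 244 ∧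
    (35:ℤ) * 14 + 61 * 20 = 1710 ∧ (10:ℤ) + 170 * 10 = 1710 ∧ (61:ℤ) * 4 = 244 := by
  norm_num

/-- **[XXXIII] 14.3 PARITY (free ι-orbits of double structures alone cannot realise the cycle class).** A free ι-pair of double vertical fibres
contributes `4` to `W·f′`, a free ι-pair of doubled theta-translates contributes `8` to `W·θ₁`; but `4 ∤ 70` and `8 ∤ 244`. More generally, with free
pairs only, `Σ 2m_i = 70` forces `Σ m_i = 35` odd (an odd multiplicity `≥ 3` occurs) and `Σ 4m_jk_j = 244` forces `Σ m_jk_j = 61` odd. [`omega` / `decide`] -/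
theorem pg20c_parity :
    (¬ ((4:ℤ) ∣ 70)) ∧ (¬ ((8:ℤ) ∣ 244)) ∧ (∀ s : ℤ, 2 * s = 70 → s % 2 = 1) ∧ (∀ s : ℤ, 4 * s = 244 → s % 2 = 1) := by
  refine ⟨by decide, by decide, fun s h => by omega, fun s h => by omega⟩

/-- **[XXXIII] 14.1 (the tracelessness dichotomy is global).** At a fixed point off `W` the two eigenlines of `𝓠(p)` carry characters whose product is
`e₂(x,β)²·c_{λ₃λ₄}(z)·(global sign) = c_{K₂²}(z)·(global sign)`, constant over all 96 points: the partner is traceless at ALL of them or at NONE.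
Arithmetic shadow: a product of two signs `a·b` with `a² = 1` is determined by `b`. [`nlinarith` / cases] -/
theorem pg20c_sign_product :
    ∀ a b : ℤ, a * a = 1 → a * a * b = b := by
  intro a b h
  rw [h]; ring

end ProductGroundTwentyAddTwo

end Summit.HodgeConjecture.HodgeConjecture.WeilTypeLadder
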